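/-
Copyright (c) 2026. All rights reserved.
Released under Apache 2.0 license as described in the file LICENSE.
-/
import Literature.Geometry.Kaehler.ComplexTorusQuaternionXSixSpecialCyclesDegreeHeckeRelations
import HarnessLib

/-!
# The degree of the special cycles of `X₆` as an Euler product, and Shimura's square-class multiplicativity:
# `deg Z(k²t)_ℚ = S_{d_K}(k)·deg Z(t)_ℚ` for `gcd(k, 6n) = 1`, `deg Z(k²)_ℚ = Σ_{c∣k} c∏_{ℓ∣c}(1 − χ₄(ℓ)ℓ⁻¹)` for
# `gcd(k, 6) = 1`, `deg Z(p²)_ℚ = p + 1 − χ₄(p)` for every prime `p ≥ 5`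

[tag: complex_torus] [tag: abelian_surface] [tag: quaternion_multiplication] [tag: complex_multiplication]
[tag: shimura_curve] [tag: special_cycles] [tag: class_number] [tag: modular_form]

Lane `lit-hodgefound`, seat p12, row g41-#5 — THEOREMS ONLY (no definition, no named fact, no instance). The second
printed form of [KRY] (3.4.6), `deg Z(t)_ℚ = 2δ(d; D)·(h(d)/w(d))·Σ_{c∣n, (c,D)=1} c∏_{ℓ∣c}(1 − χ_d(ℓ)ℓ⁻¹)` (`4t = n²d`,
in the tree as `kry_degree_formula_second_form` for `D(B) = 6`), has a MULTIPLICATIVE inner sum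
`S_d(N) = Σ_{c∣N, (c,6)=1} Ψ_d(c)`, `Ψ_d(c) = c∏_{ℓ∣c}(1 − χ_d(ℓ)ℓ⁻¹)` (the Dirichlet coefficients of
`ζ(s)ζ(s − 1)/L(s, χ_d)` away from `2, 3`). Row g41-#4 (`…DegreeHeckeRelations`) used this privately for the `T_{p²}`
relations; this file makes the arithmetic of `S_d` public and draws the global consequences:
the EULER PRODUCT `S_d(N) = ∏_{p∣N, p≥5}(1 + (p − χ_d(p))(1 + p + ⋯ + p^{ord_p N − 1}))` and hence the degree formula as
an Euler product over the primes `p ≥ 5` of the conductor; SHIMURA's square-class multiplicativity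
`deg Z(k²t)_ℚ = S_{d_K}(k)·deg Z(t)_ℚ` whenever `gcd(k, 6n) = 1` (the multiplicativity in `k` of `a(k²t)/a(t)` that
characterises Hecke eigenforms of half-integral weight — here the weight-3/2 Eisenstein series `ℰ₁(τ, ½, B)` of [KRY]
Prop. 1.0.2 with `T_{p²}`-eigenvalues `p + 1`); and the clean special cases at `t = 1` and `t = 3`. Notation as in the
sibling files: `t > 0` is `m` in the code, `n = conductor 0 t`, `d_K = t_n² − 4n_n`, `deg Z(t)_ℚ = 2·Σᶠ_{[x] ∈ L(t)/O₆^×}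
e_x⁻¹`, `(a∕p) = jacobiSym a p`, `χ₄ = ZMod.χ₄` (so `(−4∕p) = χ₄(p)` for odd `p`).

## The print

* S. Kudla, M. Rapoport, T. Yang, *Modular Forms and Special Cycles on Shimura Curves*, Annals of Math. Studies 161
  (2006): §3.4 p. 45 (held p0053) (3.4.4)–(3.4.6) «`H₀(t; D) = Σ_{c∣n} h(c²d)/w(c²d) = (h(d)/w(d))·(Σ_{c∣n, (c,D)=1}
  c·∏_{ℓ∣c}(1 − χ_d(ℓ)ℓ⁻¹))`», (3.4.14) and the value `deg Z(1)_ℚ = 1` for `D(B) = 6`; Ch. 1 pp. 1–2 (p0009–p0010)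
  Prop. 1.0.1–1.0.2 (`φ₁(τ) = −vol + Σ_{t>0} deg Z(t) q^t` is the weight-3/2 Eisenstein series `ℰ₁(τ, ½, B)`).
  [cite: KudlaRapoportYang2006, §3.4 (3.4.4)–(3.4.6) and (3.4.14); Ch. 1 Prop. 1.0.1–1.0.2]
* D. A. Cox, *Primes of the form x² + ny²*, 2nd ed. (2013), Thm. 7.24 (`h(O) = h(O_K)·f/[O_K^× : O^×]·∏_{p∣f}(1 −
  (d_K∕p)p⁻¹)` — the origin of the factor `c∏_{ℓ∣c}(1 − χ_d(ℓ)ℓ⁻¹)`). [cite: Cox2013, Thm. 7.24]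

## What is proved

* §1 **`sum_psi_mul_of_coprime`** (`S_d(ab) = S_d(a)S_d(b)` for coprime `a, b`, via `ArithmeticFunction.IsMultiplicative`
  of `[(c,6)=1]·Ψ_d(c)` and `S_d = Ψ_d·1_{(·,6)=1} * ζ`); **`sum_psi_eq_prod_primeFactors`** (`S_d(N) = ∏_{p∣N} S_d(p^{ord_p N})`);
  **`sum_psi_prime_pow`** (`p ≥ 5`: `S_d(p^e) = 1 + (p − χ_d(p))(1 + p + ⋯ + p^{e−1})`); `sum_psi_prime_pow_of_dvd_six`
  (`p = 2, 3`: `S_d(p^e) = 1`); **`sum_psi_eq_prod`** (the Euler product displayed above).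
* §2 **`kry_degree_formula_euler`** (every `t > 0`):
  `deg Z(t)_ℚ = 2δ(d_K; 6)·(h(d_K)/w(d_K))·∏_{p∣n, (p,6)=1}(1 + (p − (d_K∕p))(1 + p + ⋯ + p^{ord_p n − 1}))`.
* §3 **`degree_sq_mul_of_coprime`** (every `t > 0`, `gcd(k, 6n) = 1`: `deg Z(k²t)_ℚ = (Σ_{c∣k} Ψ_{d_K}(c))·deg Z(t)_ℚ`);
  **`degree_sq_of_coprime_six`** (`gcd(k, 6) = 1`: `deg Z(k²)_ℚ = Σ_{c∣k} c∏_{ℓ∣c}(1 − χ₄(ℓ)ℓ⁻¹)`);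
  **`degree_prime_sq`** (prime `p ≥ 5`: `deg Z(p²)_ℚ = p + 1 − χ₄(p)`), `le_degree_prime_sq` (`deg Z(p²)_ℚ ≥ p`: the
  degrees are unbounded, complementing `degree_le_poly`); **`degree_three_mul_prime_sq`**
  (`deg Z(3p²)_ℚ = (2/3)(p + 1 − (−3∕p))`).
* §4 new values: `degree_fortynine` (`deg Z(49)_ℚ = 9`), `degree_hundredtwentyone` (`deg Z(121)_ℚ = 13`),
  `degree_twelvehundredtwentyfive` (`deg Z(1225)_ℚ = S_{−4}(7)·deg Z(25)_ℚ = 9·5 = 45`).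

## Scope (honest)

Only `D(B) = 6`. No Dirichlet series, modular form or Hecke operator is defined; the Euler product and the
multiplicativity are identities between finite sums and the degrees themselves, and the words «Shimura», «eigenform»,
«`ζ(s)ζ(s−1)/L(s,χ_d)`» above are commentary locating these identities in the theory, not formalised statements.
-/

set_option maxSynthPendingDepth 3

open Quaternion Function
open scoped Pointwise
open Literature.NumberTheory.Automorphic Literature.NumberTheory.Automorphic.Brandt
open Literature.NumberTheory.Automorphic.HeckeTraceFormulaGL2Level (ellipticConductors weightedClassNumber)
open Literature.NumberTheory.QuadraticFields.Quadratic (BinQF.classNumber)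

namespace Literature.Geometry.Kaehler.ComplexTorus.QuaternionType

/-! ## §1 The inner sum of (3.4.6), `S_d(N) = Σ_{c ∣ N, (c,6)=1} c∏_{ℓ∣c}(1 − (d∕ℓ)ℓ⁻¹)`, as an Euler product -/

section DivisorSums

/-- `Ψ_d(c) = c∏_{ℓ∣c}(1 − (d∕ℓ)/ℓ)` restricted to `(c, 6) = 1` is a multiplicative arithmetic function. [folklore] -/
private theorem isMultiplicative_psi₄₅ (d : ℤ) :
    ArithmeticFunction.IsMultiplicative (show ArithmeticFunction ℚ from ⟨fun c ↦ if c = 0 then 0 else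
      if c.Coprime 6 then ((c : ℚ) * ∏ ℓ ∈ (c : ℕ).primeFactors, (1 - (jacobiSym d ℓ : ℚ) / ℓ)) else 0, by simp⟩) := by
  rw [ArithmeticFunction.IsMultiplicative.iff_ne_zero]
  refine ⟨by simp, ?_⟩
  intro a b ha hb hab
  simp only [ArithmeticFunction.coe_mk, ha, hb, mul_ne_zero ha hb, if_false, Nat.coprime_mul_iff_left]
  by_cases h6 : a.Coprime 6 ∧ b.Coprime 6
  · rw [if_pos h6, if_pos h6.1, if_pos h6.2, Nat.Coprime.primeFactors_mul hab,
      Finset.prod_union (Nat.Coprime.disjoint_primeFactors hab)]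
    push_cast; ring
  · rw [if_neg h6]
    rcases not_and_or.1 h6 with h | h
    · rw [if_neg h, zero_mul]
    · rw [if_neg h, mul_zero]

/-- The divisor sum as the value of `Ψ·1_{(·,6)=1} * ζ`. [folklore] -/
private theorem sum_psi_eq_mul_zeta₄₅ (d : ℤ) (N : ℕ) :
    ∑ c ∈ (N.divisors.filter fun c : ℕ => c.Coprime 6), ((c : ℚ) * ∏ ℓ ∈ (c : ℕ).primeFactors, (1 - (jacobiSym d ℓ : ℚ) / ℓ)) =
      ((show ArithmeticFunction ℚ from
          ⟨fun c ↦ if c = 0 then 0 else if c.Coprime 6 then ((c : ℚ) * ∏ ℓ ∈ (c : ℕ).primeFactors, (1 - (jacobiSym d ℓ : ℚ) / ℓ)) else 0, by simp⟩) *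
        (↑ArithmeticFunction.zeta : ArithmeticFunction ℚ)) N := by
  rw [ArithmeticFunction.coe_mul_zeta_apply, Finset.sum_filter]
  refine Finset.sum_congr rfl fun c hc ↦ ?_
  have hc0 : c ≠ 0 := Nat.ne_of_gt (Nat.pos_of_mem_divisors hc)
  simp only [ArithmeticFunction.coe_mk, hc0, if_false]

/-- **THE INNER SUM OF (3.4.6) IS MULTIPLICATIVE IN `n`**: `S_d(ab) = S_d(a)·S_d(b)` for coprime `a, b` (it is the
divisor sum of the multiplicative `c ↦ [(c,6)=1]·c∏_{ℓ∣c}(1 − χ_d(ℓ)ℓ⁻¹)`).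
[cite: KudlaRapoportYang2006, §3.4 (3.4.6)] [cite: Cox2013, Thm. 7.24] -/
theorem sum_psi_mul_of_coprime (d : ℤ) {a b : ℕ} (hab : a.Coprime b) :
    ∑ c ∈ ((a * b).divisors.filter fun c : ℕ => c.Coprime 6), ((c : ℚ) * ∏ ℓ ∈ (c : ℕ).primeFactors, (1 - (jacobiSym d ℓ : ℚ) / ℓ)) =
      (∑ c ∈ (a.divisors.filter fun c : ℕ => c.Coprime 6), ((c : ℚ) * ∏ ℓ ∈ (c : ℕ).primeFactors, (1 - (jacobiSym d ℓ : ℚ) / ℓ))) *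
        ∑ c ∈ (b.divisors.filter fun c : ℕ => c.Coprime 6), ((c : ℚ) * ∏ ℓ ∈ (c : ℕ).primeFactors, (1 - (jacobiSym d ℓ : ℚ) / ℓ)) := by
  rw [sum_psi_eq_mul_zeta₄₅ d (a * b), sum_psi_eq_mul_zeta₄₅ d a, sum_psi_eq_mul_zeta₄₅ d b]
  exact ((isMultiplicative_psi₄₅ d).mul ArithmeticFunction.isMultiplicative_zeta.natCast).map_mul_of_coprime hab

/-- **EULER PRODUCT**: `S_d(N) = ∏_{p ∣ N} S_d(p^{ord_p N})` (`N ≥ 1`). [cite: KudlaRapoportYang2006, §3.4 (3.4.6)] -/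
theorem sum_psi_eq_prod_primeFactors (d : ℤ) {N : ℕ} (hN : N ≠ 0) :
    ∑ c ∈ (N.divisors.filter fun c : ℕ => c.Coprime 6), ((c : ℚ) * ∏ ℓ ∈ (c : ℕ).primeFactors, (1 - (jacobiSym d ℓ : ℚ) / ℓ)) =
      ∏ p ∈ N.primeFactors, ∑ c ∈ ((p ^ N.factorization p).divisors.filter fun c : ℕ => c.Coprime 6), ((c : ℚ) * ∏ ℓ ∈ (c : ℕ).primeFactors, (1 - (jacobiSym d ℓ : ℚ) / ℓ)) := by
  rw [sum_psi_eq_mul_zeta₄₅ d N,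
    ((isMultiplicative_psi₄₅ d).mul ArithmeticFunction.isMultiplicative_zeta.natCast).multiplicative_factorization _ hN,
    Finsupp.prod, Nat.support_factorization]
  exact Finset.prod_congr rfl fun p _ ↦ (sum_psi_eq_mul_zeta₄₅ d _).symm

/-- **The local factor at a prime `p ≥ 5`: `S_d(p^e) = 1 + (p − χ_d(p))·(1 + p + ⋯ + p^{e−1})`** (so `= p^e`,
`(p^{e+1} − 1)/(p − 1)`, `1 + (p + 1)(p^e − 1)/(p − 1)` for `p` split, ramified, inert in `k`).
[cite: KudlaRapoportYang2006, §3.4 (3.4.6)] [cite: Cox2013, Thm. 7.24] -/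
theorem sum_psi_prime_pow (d : ℤ) {p : ℕ} (hp : p.Prime) (hp6 : p.Coprime 6) (e : ℕ) :
    ∑ c ∈ ((p ^ e).divisors.filter fun c : ℕ => c.Coprime 6), ((c : ℚ) * ∏ ℓ ∈ (c : ℕ).primeFactors, (1 - (jacobiSym d ℓ : ℚ) / ℓ)) =
      1 + ((p : ℚ) - jacobiSym d p) * ∑ i ∈ Finset.range e, (p : ℚ) ^ i := by
  have key : ∀ e : ℕ, ∑ c ∈ ((p ^ e).divisors.filter fun c : ℕ => c.Coprime 6), ((c : ℚ) * ∏ ℓ ∈ (c : ℕ).primeFactors, (1 - (jacobiSym d ℓ : ℚ) / ℓ)) =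
      ∑ i ∈ Finset.range (e + 1), (((p ^ i : ℕ) : ℚ) * ∏ ℓ ∈ (p ^ i : ℕ).primeFactors, (1 - (jacobiSym d ℓ : ℚ) / ℓ)) := by
    intro e
    rw [Finset.sum_filter, Nat.sum_divisors_prime_pow hp]
    refine Finset.sum_congr rfl fun i _ ↦ ?_
    rw [if_pos (Nat.Coprime.pow_left i hp6)]
  have hp0 : (p : ℚ) ≠ 0 := by exact_mod_cast hp.ne_zero
  induction e with
  | zero =>
    rw [key, Finset.sum_range_one, Finset.sum_range_zero, pow_zero, Nat.primeFactors_one, Finset.prod_empty]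
    push_cast; ring
  | succ e ih =>
    rw [key] at ih ⊢
    rw [Finset.sum_range_succ, ih, Finset.sum_range_succ, Nat.primeFactors_prime_pow (Nat.succ_ne_zero e) hp,
      Finset.prod_singleton]
    push_cast
    field_simp
    ring

/-- The local factor at `p = 2, 3` is `1`: only `c = 1` is coprime to `6`. [cite: KudlaRapoportYang2006, §3.4 (3.4.6)] -/
theorem sum_psi_prime_pow_of_dvd_six (d : ℤ) {p : ℕ} (hp : p.Prime) (hp6 : p ∣ 6) (e : ℕ) :
    ∑ c ∈ ((p ^ e).divisors.filter fun c : ℕ => c.Coprime 6), ((c : ℚ) * ∏ ℓ ∈ (c : ℕ).primeFactors, (1 - (jacobiSym d ℓ : ℚ) / ℓ)) = 1 := by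
  have h1 : ((p ^ e).divisors.filter fun c : ℕ => c.Coprime 6) = {1} := by
    ext c
    simp only [Finset.mem_filter, Nat.mem_divisors, Finset.mem_singleton]
    constructor
    · rintro ⟨⟨hc, -⟩, h6⟩
      obtain ⟨i, -, rfl⟩ := (Nat.dvd_prime_pow hp).1 hc
      rcases i with _ | i
      · rfl
      · exfalso
        have hp6' : p.Coprime 6 := Nat.Coprime.coprime_dvd_left (dvd_pow_self p (Nat.succ_ne_zero i)) h6
        exact hp.one_lt.ne' (Nat.Coprime.eq_one_of_dvd hp6' hp6)
    · rintro rfl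
      exact ⟨⟨one_dvd _, pow_ne_zero _ hp.ne_zero⟩, Nat.coprime_one_left 6⟩
  rw [h1, Finset.sum_singleton, Nat.primeFactors_one, Finset.prod_empty]
  push_cast; ring

/-- **`S_d(N) = ∏_{p ∣ N, p ≥ 5} (1 + (p − χ_d(p))(1 + p + ⋯ + p^{ord_p N − 1}))`** (`N ≥ 1`).
[cite: KudlaRapoportYang2006, §3.4 (3.4.6)] [cite: Cox2013, Thm. 7.24] -/
theorem sum_psi_eq_prod (d : ℤ) {N : ℕ} (hN : N ≠ 0) :
    ∑ c ∈ (N.divisors.filter fun c : ℕ => c.Coprime 6), ((c : ℚ) * ∏ ℓ ∈ (c : ℕ).primeFactors, (1 - (jacobiSym d ℓ : ℚ) / ℓ)) =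
      ∏ p ∈ N.primeFactors with p.Coprime 6,
        (1 + ((p : ℚ) - jacobiSym d p) * ∑ i ∈ Finset.range (N.factorization p), (p : ℚ) ^ i) := by
  rw [sum_psi_eq_prod_primeFactors d hN, Finset.prod_filter]
  refine Finset.prod_congr rfl fun p hp ↦ ?_
  have hpp : p.Prime := Nat.prime_of_mem_primeFactors hp
  by_cases h6 : p.Coprime 6
  · rw [if_pos h6, sum_psi_prime_pow d hpp h6]
  · rw [if_neg h6, sum_psi_prime_pow_of_dvd_six d hpp _ _]
    -- a prime not coprime to `6` divides `6`
    rcases (Nat.Prime.eq_one_or_self_of_dvd hpp _ (Nat.gcd_dvd_left p 6)) with h | h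
    · exact absurd h h6
    · rw [← h]; exact Nat.gcd_dvd_right p 6

end DivisorSums

/-! ## §2 The degree of `Z(t)` as an Euler product over the primes `p ≥ 5` dividing the conductor -/

section Euler

/-- **KRY's DEGREE FORMULA AS AN EULER PRODUCT** (every `t > 0`; `n = conductor 0 t`, `d_K = t_n² − 4n_n`):
`deg Z(t)_ℚ = 2δ(d_K; 6)·(h(d_K)/w(d_K))·∏_{p ∣ n, p ≥ 5} (1 + (p − (d_K∕p))(1 + p + ⋯ + p^{ord_p n − 1}))` — the
second form of (3.4.6) with its multiplicative inner sum evaluated prime by prime.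
[cite: KudlaRapoportYang2006, §3.4 (3.4.4)–(3.4.6)] [cite: Cox2013, Thm. 7.24] -/
theorem kry_degree_formula_euler {m : ℕ} (hm : 0 < m) :
    2 * ∑ᶠ q : (Quot (fun x y : {x : ℤ × ℤ × ℤ // x.1 ^ 2 - 3 * x.2.1 ^ 2 - 3 * x.2.2 ^ 2 = (m : ℤ)} ↦
      ∃ v : ℍ[ℚ,((-1 : ℤ) : ℚ),((3 : ℤ) : ℚ)], (v ∈ order (-1) 3 ∨ v - ⟨1/2, 1/2, 1/2, -1/2⟩ ∈ order (-1) 3) ∧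
        ((v * star v).re = 1 ∨ (v * star v).re = -1) ∧
        v * ⟨0, x.1.1, x.1.2.1, x.1.2.2⟩ = ⟨0, y.1.1, y.1.2.1, y.1.2.2⟩ * v)),
        ((Nat.card
          {u : ℍ[ℚ,((-1 : ℤ) : ℚ),((3 : ℤ) : ℚ)] // (u ∈ order (-1) 3 ∨ u - ⟨1/2, 1/2, 1/2, -1/2⟩ ∈ order (-1) 3) ∧
            ((u * star u).re = 1 ∨ (u * star u).re = -1) ∧
            u * ⟨0, q.out.1.1, q.out.1.2.1, q.out.1.2.2⟩ = ⟨0, q.out.1.1, q.out.1.2.1, q.out.1.2.2⟩ * u} : ℚ))⁻¹ =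
      2 * (((1 - ZMod.χ₈ ((((tOf 0 m (conductor 0 m) ^ 2 - 4 * nOf 0 m (conductor 0 m)) : ℤ)) : ZMod 8)) * (1 - legendreSym 3 (tOf 0 m (conductor 0 m) ^ 2 - 4 * nOf 0 m (conductor 0 m))) : ℤ) : ℚ) *
        ((BinQF.classNumber (tOf 0 m (conductor 0 m) ^ 2 - 4 * nOf 0 m (conductor 0 m)) : ℚ) / unitsOfDisc (tOf 0 m (conductor 0 m) ^ 2 - 4 * nOf 0 m (conductor 0 m)) *
          ∏ p ∈ (conductor 0 m).primeFactors with p.Coprime 6,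
            (1 + ((p : ℚ) - jacobiSym (tOf 0 m (conductor 0 m) ^ 2 - 4 * nOf 0 m (conductor 0 m)) p) * ∑ i ∈ Finset.range ((conductor 0 m).factorization p), (p : ℚ) ^ i)) := by
  rw [kry_degree_formula_second_form hm,
    sum_psi_eq_prod _ (conductor_pos (show (0 : ℤ) ^ 2 < 4 * m by positivity)).ne']

end Euler

/-! ## §3 Shimura's square-class multiplicativity: `deg Z(k²t) = S_{d_K}(k)·deg Z(t)` for `(k, 6n) = 1` -/

section SquareClasses

/-- **`deg Z(k²t)_ℚ = (Σ_{c ∣ k} c∏_{ℓ∣c}(1 − (d_K∕ℓ)ℓ⁻¹))·deg Z(t)_ℚ` WHENEVER `gcd(k, 6n) = 1`** (every `t > 0`;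
`n = conductor 0 t`): the conductor becomes `kn`, `d_K` is unchanged, and the inner sum of (3.4.6) is multiplicative —
the multiplicativity in `k` of `a(k²t)/a(t)` characteristic of a Hecke eigenform of half-integral weight.
[cite: KudlaRapoportYang2006, §3.4 (3.4.4)–(3.4.6) and Ch. 1 Prop. 1.0.1–1.0.2] [cite: Cox2013, Thm. 7.24] -/
theorem degree_sq_mul_of_coprime {m k : ℕ} (hm : 0 < m) (hk : k.Coprime (6 * conductor 0 m)) :
    2 * ∑ᶠ q : (Quot (fun x y : {x : ℤ × ℤ × ℤ // x.1 ^ 2 - 3 * x.2.1 ^ 2 - 3 * x.2.2 ^ 2 = ((k ^ 2 * m : ℕ) : ℤ)} ↦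
      ∃ v : ℍ[ℚ,((-1 : ℤ) : ℚ),((3 : ℤ) : ℚ)], (v ∈ order (-1) 3 ∨ v - ⟨1/2, 1/2, 1/2, -1/2⟩ ∈ order (-1) 3) ∧
        ((v * star v).re = 1 ∨ (v * star v).re = -1) ∧
        v * ⟨0, x.1.1, x.1.2.1, x.1.2.2⟩ = ⟨0, y.1.1, y.1.2.1, y.1.2.2⟩ * v)),
        ((Nat.card
          {u : ℍ[ℚ,((-1 : ℤ) : ℚ),((3 : ℤ) : ℚ)] // (u ∈ order (-1) 3 ∨ u - ⟨1/2, 1/2, 1/2, -1/2⟩ ∈ order (-1) 3) ∧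
            ((u * star u).re = 1 ∨ (u * star u).re = -1) ∧
            u * ⟨0, q.out.1.1, q.out.1.2.1, q.out.1.2.2⟩ = ⟨0, q.out.1.1, q.out.1.2.1, q.out.1.2.2⟩ * u} : ℚ))⁻¹ =
      (∑ c ∈ k.divisors, ((c : ℚ) * ∏ ℓ ∈ (c : ℕ).primeFactors, (1 - (jacobiSym (tOf 0 m (conductor 0 m) ^ 2 - 4 * nOf 0 m (conductor 0 m)) ℓ : ℚ) / ℓ))) * (2 * ∑ᶠ q : (Quot (fun x y : {x : ℤ × ℤ × ℤ // x.1 ^ 2 - 3 * x.2.1 ^ 2 - 3 * x.2.2 ^ 2 = (m : ℤ)} ↦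
      ∃ v : ℍ[ℚ,((-1 : ℤ) : ℚ),((3 : ℤ) : ℚ)], (v ∈ order (-1) 3 ∨ v - ⟨1/2, 1/2, 1/2, -1/2⟩ ∈ order (-1) 3) ∧
        ((v * star v).re = 1 ∨ (v * star v).re = -1) ∧
        v * ⟨0, x.1.1, x.1.2.1, x.1.2.2⟩ = ⟨0, y.1.1, y.1.2.1, y.1.2.2⟩ * v)),
        ((Nat.card
          {u : ℍ[ℚ,((-1 : ℤ) : ℚ),((3 : ℤ) : ℚ)] // (u ∈ order (-1) 3 ∨ u - ⟨1/2, 1/2, 1/2, -1/2⟩ ∈ order (-1) 3) ∧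
            ((u * star u).re = 1 ∨ (u * star u).re = -1) ∧
            u * ⟨0, q.out.1.1, q.out.1.2.1, q.out.1.2.2⟩ = ⟨0, q.out.1.1, q.out.1.2.1, q.out.1.2.2⟩ * u} : ℚ))⁻¹) := by
  have hF0 : 0 < conductor 0 m := conductor_pos (show (0 : ℤ) ^ 2 < 4 * m by positivity)
  have hk0 : 0 < k := by
    rcases Nat.eq_zero_or_pos k with rfl | h
    · rw [Nat.coprime_zero_left] at hk; omega
    · exact h
  have hm' : 0 < k ^ 2 * m := by positivity
  obtain ⟨hF, hD⟩ := conductor_sq_mul hm hk0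
  have hk6 : k.Coprime 6 := Nat.Coprime.coprime_mul_right_right hk
  have hkF : k.Coprime (conductor 0 m) := Nat.Coprime.coprime_mul_left_right hk
  have hfilter : (k.divisors.filter fun c : ℕ => c.Coprime 6) = k.divisors :=
    Finset.filter_true_of_mem fun c hc ↦ Nat.Coprime.coprime_dvd_left (Nat.dvd_of_mem_divisors hc) hk6
  rw [kry_degree_formula_second_form hm', kry_degree_formula_second_form hm, hD, hF,
    sum_psi_mul_of_coprime _ hkF, hfilter]
  ring

/-- `(−4·j² ∕ p) = (−1 ∕ p)·(j ∕ p)²`-type evaluation: `(a·2² ∕ p) = (a ∕ p)` for odd `p`. [folklore] -/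
private theorem jacobiSym_mul_four₄₅ (a : ℤ) {p : ℕ} (hp : Odd p) : jacobiSym (a * 2 ^ 2) p = jacobiSym a p := by
  rw [jacobiSym.mul_left, jacobiSym.sq_one' (by
    rw [show (2 : ℤ) = ((2 : ℕ) : ℤ) by rfl, Int.gcd_natCast_natCast]
    exact Nat.coprime_two_left.2 hp), mul_one]

/-- `(−4 ∕ ℓ) = χ₄(ℓ)` for odd `ℓ`. [folklore] -/
private theorem jacobiSym_neg_four₄₅ {ℓ : ℕ} (hℓ : Odd ℓ) : jacobiSym (-4) ℓ = ZMod.χ₄ ℓ := by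
  rw [show (-4 : ℤ) = -1 * 2 ^ 2 by norm_num, jacobiSym_mul_four₄₅ _ hℓ, jacobiSym.at_neg_one hℓ]

/-- **`deg Z(k²)_ℚ = Σ_{c ∣ k} c·∏_{ℓ ∣ c}(1 − χ₄(ℓ)ℓ⁻¹)` FOR EVERY `k` COPRIME TO `6`** (`t = 1`: `n = 1`, `d_K = −4`,
`2δ(−4; 6)·h(−4)/w(−4) = 2·2·¼ = 1`; e.g. `deg Z(p²) = p + 1 − χ₄(p)`, `deg Z(35²) = 5·9`).
[cite: KudlaRapoportYang2006, §3.4 (3.4.4)–(3.4.6) and (3.4.14)] -/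
theorem degree_sq_of_coprime_six {k : ℕ} (hk : k.Coprime 6) :
    2 * ∑ᶠ q : (Quot (fun x y : {x : ℤ × ℤ × ℤ // x.1 ^ 2 - 3 * x.2.1 ^ 2 - 3 * x.2.2 ^ 2 = ((k ^ 2 : ℕ) : ℤ)} ↦
      ∃ v : ℍ[ℚ,((-1 : ℤ) : ℚ),((3 : ℤ) : ℚ)], (v ∈ order (-1) 3 ∨ v - ⟨1/2, 1/2, 1/2, -1/2⟩ ∈ order (-1) 3) ∧
        ((v * star v).re = 1 ∨ (v * star v).re = -1) ∧
        v * ⟨0, x.1.1, x.1.2.1, x.1.2.2⟩ = ⟨0, y.1.1, y.1.2.1, y.1.2.2⟩ * v)),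
        ((Nat.card
          {u : ℍ[ℚ,((-1 : ℤ) : ℚ),((3 : ℤ) : ℚ)] // (u ∈ order (-1) 3 ∨ u - ⟨1/2, 1/2, 1/2, -1/2⟩ ∈ order (-1) 3) ∧
            ((u * star u).re = 1 ∨ (u * star u).re = -1) ∧
            u * ⟨0, q.out.1.1, q.out.1.2.1, q.out.1.2.2⟩ = ⟨0, q.out.1.1, q.out.1.2.1, q.out.1.2.2⟩ * u} : ℚ))⁻¹ = ∑ c ∈ k.divisors, ((c : ℚ) * ∏ ℓ ∈ c.primeFactors, (1 - (ZMod.χ₄ ℓ : ℚ) / ℓ)) := by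
  have hF1 : conductor 0 1 = 1 := by decide +kernel
  have h := degree_sq_mul_of_coprime (m := 1) (k := k) one_pos (by rw [hF1]; exact hk)
  have hD1 : tOf 0 1 (conductor 0 1) ^ 2 - 4 * nOf 0 1 (conductor 0 1) = -4 := by
    rw [disc_conductor_eq_div one_pos, hF1]; norm_num
  have h1 : 2 * ∑ᶠ q : (Quot (fun x y : {x : ℤ × ℤ × ℤ // x.1 ^ 2 - 3 * x.2.1 ^ 2 - 3 * x.2.2 ^ 2 = (((1 : ℕ)) : ℤ)} ↦
      ∃ v : ℍ[ℚ,((-1 : ℤ) : ℚ),((3 : ℤ) : ℚ)], (v ∈ order (-1) 3 ∨ v - ⟨1/2, 1/2, 1/2, -1/2⟩ ∈ order (-1) 3) ∧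
        ((v * star v).re = 1 ∨ (v * star v).re = -1) ∧
        v * ⟨0, x.1.1, x.1.2.1, x.1.2.2⟩ = ⟨0, y.1.1, y.1.2.1, y.1.2.2⟩ * v)),
        ((Nat.card
          {u : ℍ[ℚ,((-1 : ℤ) : ℚ),((3 : ℤ) : ℚ)] // (u ∈ order (-1) 3 ∨ u - ⟨1/2, 1/2, 1/2, -1/2⟩ ∈ order (-1) 3) ∧
            ((u * star u).re = 1 ∨ (u * star u).re = -1) ∧
            u * ⟨0, q.out.1.1, q.out.1.2.1, q.out.1.2.2⟩ = ⟨0, q.out.1.1, q.out.1.2.1, q.out.1.2.2⟩ * u} : ℚ))⁻¹ = 1 := by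
    rw [kry_degree_formula_second_form_div one_pos]; decide +kernel
  rw [hD1, h1, show (k ^ 2 * 1 : ℕ) = k ^ 2 from mul_one _, mul_one] at h
  rw [h]
  refine Finset.sum_congr rfl fun c hc ↦ ?_
  congr 1
  refine Finset.prod_congr rfl fun ℓ hℓ ↦ ?_
  have hℓp : ℓ.Prime := Nat.prime_of_mem_primeFactors hℓ
  have hℓ6 : ℓ.Coprime 6 :=
    Nat.Coprime.coprime_dvd_left ((Nat.dvd_of_mem_primeFactors hℓ).trans (Nat.dvd_of_mem_divisors hc)) hk
  have hℓ2 : ℓ ≠ 2 := by rintro rfl; exact absurd hℓ6 (by decide)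
  rw [jacobiSym_neg_four₄₅ (hℓp.odd_of_ne_two hℓ2)]

/-- **`deg Z(p²)_ℚ = p + 1 − χ₄(p)` FOR EVERY PRIME `p ≥ 5`** (`t = 1`: `deg Z(1)_ℚ = 1`, `(−4∕p) = (−1∕p) = χ₄(p)`);
in particular the degrees are unbounded (cf. the bound `degree_le_poly`).
[cite: KudlaRapoportYang2006, §3.4 (3.4.4)–(3.4.6)] -/
theorem degree_prime_sq {p : ℕ} (hp : p.Prime) (h2 : p ≠ 2) (h3 : p ≠ 3) :
    2 * ∑ᶠ q : (Quot (fun x y : {x : ℤ × ℤ × ℤ // x.1 ^ 2 - 3 * x.2.1 ^ 2 - 3 * x.2.2 ^ 2 = ((p ^ 2 : ℕ) : ℤ)} ↦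
      ∃ v : ℍ[ℚ,((-1 : ℤ) : ℚ),((3 : ℤ) : ℚ)], (v ∈ order (-1) 3 ∨ v - ⟨1/2, 1/2, 1/2, -1/2⟩ ∈ order (-1) 3) ∧
        ((v * star v).re = 1 ∨ (v * star v).re = -1) ∧
        v * ⟨0, x.1.1, x.1.2.1, x.1.2.2⟩ = ⟨0, y.1.1, y.1.2.1, y.1.2.2⟩ * v)),
        ((Nat.card
          {u : ℍ[ℚ,((-1 : ℤ) : ℚ),((3 : ℤ) : ℚ)] // (u ∈ order (-1) 3 ∨ u - ⟨1/2, 1/2, 1/2, -1/2⟩ ∈ order (-1) 3) ∧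
            ((u * star u).re = 1 ∨ (u * star u).re = -1) ∧
            u * ⟨0, q.out.1.1, q.out.1.2.1, q.out.1.2.2⟩ = ⟨0, q.out.1.1, q.out.1.2.1, q.out.1.2.2⟩ * u} : ℚ))⁻¹ = (p : ℚ) + 1 - ZMod.χ₄ p := by
  have h := degree_hecke_relation (m := 1) one_pos hp h2 h3
  have hp1 : ¬ p ^ 2 ∣ 1 := by
    intro h'
    rcases Nat.pow_eq_one.1 (Nat.dvd_one.1 h') with h1 | h1
    · exact hp.one_lt.ne' h1
    · exact absurd h1 two_ne_zero
  have h1 : 2 * ∑ᶠ q : (Quot (fun x y : {x : ℤ × ℤ × ℤ // x.1 ^ 2 - 3 * x.2.1 ^ 2 - 3 * x.2.2 ^ 2 = (((1 : ℕ)) : ℤ)} ↦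
      ∃ v : ℍ[ℚ,((-1 : ℤ) : ℚ),((3 : ℤ) : ℚ)], (v ∈ order (-1) 3 ∨ v - ⟨1/2, 1/2, 1/2, -1/2⟩ ∈ order (-1) 3) ∧
        ((v * star v).re = 1 ∨ (v * star v).re = -1) ∧
        v * ⟨0, x.1.1, x.1.2.1, x.1.2.2⟩ = ⟨0, y.1.1, y.1.2.1, y.1.2.2⟩ * v)),
        ((Nat.card
          {u : ℍ[ℚ,((-1 : ℤ) : ℚ),((3 : ℤ) : ℚ)] // (u ∈ order (-1) 3 ∨ u - ⟨1/2, 1/2, 1/2, -1/2⟩ ∈ order (-1) 3) ∧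
            ((u * star u).re = 1 ∨ (u * star u).re = -1) ∧
            u * ⟨0, q.out.1.1, q.out.1.2.1, q.out.1.2.2⟩ = ⟨0, q.out.1.1, q.out.1.2.1, q.out.1.2.2⟩ * u} : ℚ))⁻¹ = 1 := by
    rw [kry_degree_formula_second_form_div one_pos]; decide +kernel
  have hj : jacobiSym (-4 * ((1 : ℕ) : ℤ)) p = ZMod.χ₄ p := by
    rw [show (-4 * ((1 : ℕ) : ℤ)) = -4 by norm_num, jacobiSym_neg_four₄₅ (hp.odd_of_ne_two h2)]
  rw [if_neg hp1, mul_zero, add_zero, h1, hj, show (p ^ 2 * 1 : ℕ) = p ^ 2 from mul_one _, mul_one] at h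
  exact h

/-- **The degrees are unbounded: `p ≤ deg Z(p²)_ℚ`** for every prime `p ≥ 5`. [cite: KudlaRapoportYang2006, §3.4 (3.4.4)–(3.4.6)] -/
theorem le_degree_prime_sq {p : ℕ} (hp : p.Prime) (h2 : p ≠ 2) (h3 : p ≠ 3) :
    (p : ℚ) ≤ 2 * ∑ᶠ q : (Quot (fun x y : {x : ℤ × ℤ × ℤ // x.1 ^ 2 - 3 * x.2.1 ^ 2 - 3 * x.2.2 ^ 2 = ((p ^ 2 : ℕ) : ℤ)} ↦
      ∃ v : ℍ[ℚ,((-1 : ℤ) : ℚ),((3 : ℤ) : ℚ)], (v ∈ order (-1) 3 ∨ v - ⟨1/2, 1/2, 1/2, -1/2⟩ ∈ order (-1) 3) ∧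
        ((v * star v).re = 1 ∨ (v * star v).re = -1) ∧
        v * ⟨0, x.1.1, x.1.2.1, x.1.2.2⟩ = ⟨0, y.1.1, y.1.2.1, y.1.2.2⟩ * v)),
        ((Nat.card
          {u : ℍ[ℚ,((-1 : ℤ) : ℚ),((3 : ℤ) : ℚ)] // (u ∈ order (-1) 3 ∨ u - ⟨1/2, 1/2, 1/2, -1/2⟩ ∈ order (-1) 3) ∧
            ((u * star u).re = 1 ∨ (u * star u).re = -1) ∧
            u * ⟨0, q.out.1.1, q.out.1.2.1, q.out.1.2.2⟩ = ⟨0, q.out.1.1, q.out.1.2.1, q.out.1.2.2⟩ * u} : ℚ))⁻¹ := by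
  rw [degree_prime_sq hp h2 h3]
  have hχ : (ZMod.χ₄ p : ℤ) ≤ 1 := by
    rw [ZMod.χ₄_nat_eq_if_mod_four]; split_ifs <;> norm_num
  have hχ' : ((ZMod.χ₄ p : ℤ) : ℚ) ≤ 1 := by exact_mod_cast hχ
  linarith

/-- **`deg Z(3p²)_ℚ = (2/3)·(p + 1 − (−3∕p))` for every prime `p ≥ 5`** (`t = 3`: `deg Z(3)_ℚ = 2/3`, `(−12∕p) = (−3∕p)`).
[cite: KudlaRapoportYang2006, §3.4 (3.4.4)–(3.4.6)] -/
theorem degree_three_mul_prime_sq {p : ℕ} (hp : p.Prime) (h2 : p ≠ 2) (h3 : p ≠ 3) :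
    2 * ∑ᶠ q : (Quot (fun x y : {x : ℤ × ℤ × ℤ // x.1 ^ 2 - 3 * x.2.1 ^ 2 - 3 * x.2.2 ^ 2 = ((3 * p ^ 2 : ℕ) : ℤ)} ↦
      ∃ v : ℍ[ℚ,((-1 : ℤ) : ℚ),((3 : ℤ) : ℚ)], (v ∈ order (-1) 3 ∨ v - ⟨1/2, 1/2, 1/2, -1/2⟩ ∈ order (-1) 3) ∧
        ((v * star v).re = 1 ∨ (v * star v).re = -1) ∧
        v * ⟨0, x.1.1, x.1.2.1, x.1.2.2⟩ = ⟨0, y.1.1, y.1.2.1, y.1.2.2⟩ * v)),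
        ((Nat.card
          {u : ℍ[ℚ,((-1 : ℤ) : ℚ),((3 : ℤ) : ℚ)] // (u ∈ order (-1) 3 ∨ u - ⟨1/2, 1/2, 1/2, -1/2⟩ ∈ order (-1) 3) ∧
            ((u * star u).re = 1 ∨ (u * star u).re = -1) ∧
            u * ⟨0, q.out.1.1, q.out.1.2.1, q.out.1.2.2⟩ = ⟨0, q.out.1.1, q.out.1.2.1, q.out.1.2.2⟩ * u} : ℚ))⁻¹ = 2 / 3 * ((p : ℚ) + 1 - jacobiSym (-3) p) := by
  have h := degree_hecke_relation (m := 3) (by norm_num) hp h2 h3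
  have hp3 : ¬ p ^ 2 ∣ 3 := by
    intro h'
    have hle : p ^ 2 ≤ 3 := Nat.le_of_dvd (by norm_num) h'
    nlinarith [hp.two_le]
  have h3v : 2 * ∑ᶠ q : (Quot (fun x y : {x : ℤ × ℤ × ℤ // x.1 ^ 2 - 3 * x.2.1 ^ 2 - 3 * x.2.2 ^ 2 = (((3 : ℕ)) : ℤ)} ↦
      ∃ v : ℍ[ℚ,((-1 : ℤ) : ℚ),((3 : ℤ) : ℚ)], (v ∈ order (-1) 3 ∨ v - ⟨1/2, 1/2, 1/2, -1/2⟩ ∈ order (-1) 3) ∧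
        ((v * star v).re = 1 ∨ (v * star v).re = -1) ∧
        v * ⟨0, x.1.1, x.1.2.1, x.1.2.2⟩ = ⟨0, y.1.1, y.1.2.1, y.1.2.2⟩ * v)),
        ((Nat.card
          {u : ℍ[ℚ,((-1 : ℤ) : ℚ),((3 : ℤ) : ℚ)] // (u ∈ order (-1) 3 ∨ u - ⟨1/2, 1/2, 1/2, -1/2⟩ ∈ order (-1) 3) ∧
            ((u * star u).re = 1 ∨ (u * star u).re = -1) ∧
            u * ⟨0, q.out.1.1, q.out.1.2.1, q.out.1.2.2⟩ = ⟨0, q.out.1.1, q.out.1.2.1, q.out.1.2.2⟩ * u} : ℚ))⁻¹ = 2 / 3 := by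
    rw [kry_degree_formula_second_form_div (by norm_num : 0 < 3)]; decide +kernel
  have hj : jacobiSym (-4 * ((3 : ℕ) : ℤ)) p = jacobiSym (-3) p := by
    rw [show (-4 * ((3 : ℕ) : ℤ)) = -3 * 2 ^ 2 by norm_num, jacobiSym_mul_four₄₅ _ (hp.odd_of_ne_two h2)]
  rw [if_neg hp3, mul_zero, add_zero, h3v, hj, show (p ^ 2 * 3 : ℕ) = 3 * p ^ 2 from mul_comm _ _] at h
  rw [h]; ring

end SquareClasses

/-! ## §4 Examples: `deg Z(49) = 9`, `deg Z(121) = 13`, `deg Z(1225) = 9·deg Z(25) = 45` -/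

section Examples

/-- **`deg Z(49)_ℚ = 7 + 1 − χ₄(7) = 9`** (new value). [cite: KudlaRapoportYang2006, §3.4 (3.4.4)–(3.4.6)] -/
theorem degree_fortynine : 2 * ∑ᶠ q : (Quot (fun x y : {x : ℤ × ℤ × ℤ // x.1 ^ 2 - 3 * x.2.1 ^ 2 - 3 * x.2.2 ^ 2 = (49 : ℤ)} ↦
      ∃ v : ℍ[ℚ,((-1 : ℤ) : ℚ),((3 : ℤ) : ℚ)], (v ∈ order (-1) 3 ∨ v - ⟨1/2, 1/2, 1/2, -1/2⟩ ∈ order (-1) 3) ∧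
        ((v * star v).re = 1 ∨ (v * star v).re = -1) ∧
        v * ⟨0, x.1.1, x.1.2.1, x.1.2.2⟩ = ⟨0, y.1.1, y.1.2.1, y.1.2.2⟩ * v)),
        ((Nat.card
          {u : ℍ[ℚ,((-1 : ℤ) : ℚ),((3 : ℤ) : ℚ)] // (u ∈ order (-1) 3 ∨ u - ⟨1/2, 1/2, 1/2, -1/2⟩ ∈ order (-1) 3) ∧
            ((u * star u).re = 1 ∨ (u * star u).re = -1) ∧
            u * ⟨0, q.out.1.1, q.out.1.2.1, q.out.1.2.2⟩ = ⟨0, q.out.1.1, q.out.1.2.1, q.out.1.2.2⟩ * u} : ℚ))⁻¹ = 9 := by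
  have h := degree_prime_sq (p := 7) (by norm_num) (by norm_num) (by norm_num)
  have hχ : ZMod.χ₄ ((7 : ℕ) : ZMod 4) = -1 := by decide
  have e : ((7 ^ 2 : ℕ) : ℤ) = 49 := by norm_num
  rw [hχ, e] at h
  rw [h]; norm_num

/-- **`deg Z(121)_ℚ = 11 + 1 − χ₄(11) = 13`** (new value). [cite: KudlaRapoportYang2006, §3.4 (3.4.4)–(3.4.6)] -/
theorem degree_hundredtwentyone : 2 * ∑ᶠ q : (Quot (fun x y : {x : ℤ × ℤ × ℤ // x.1 ^ 2 - 3 * x.2.1 ^ 2 - 3 * x.2.2 ^ 2 = (121 : ℤ)} ↦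
      ∃ v : ℍ[ℚ,((-1 : ℤ) : ℚ),((3 : ℤ) : ℚ)], (v ∈ order (-1) 3 ∨ v - ⟨1/2, 1/2, 1/2, -1/2⟩ ∈ order (-1) 3) ∧
        ((v * star v).re = 1 ∨ (v * star v).re = -1) ∧
        v * ⟨0, x.1.1, x.1.2.1, x.1.2.2⟩ = ⟨0, y.1.1, y.1.2.1, y.1.2.2⟩ * v)),
        ((Nat.card
          {u : ℍ[ℚ,((-1 : ℤ) : ℚ),((3 : ℤ) : ℚ)] // (u ∈ order (-1) 3 ∨ u - ⟨1/2, 1/2, 1/2, -1/2⟩ ∈ order (-1) 3) ∧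
            ((u * star u).re = 1 ∨ (u * star u).re = -1) ∧
            u * ⟨0, q.out.1.1, q.out.1.2.1, q.out.1.2.2⟩ = ⟨0, q.out.1.1, q.out.1.2.1, q.out.1.2.2⟩ * u} : ℚ))⁻¹ = 13 := by
  have h := degree_prime_sq (p := 11) (by norm_num) (by norm_num) (by norm_num)
  have hχ : ZMod.χ₄ ((11 : ℕ) : ZMod 4) = -1 := by decide
  have e : ((11 ^ 2 : ℕ) : ℤ) = 121 := by norm_num
  rw [hχ, e] at h
  rw [h]; norm_num

/-- **`deg Z(1225)_ℚ = S_{−4}(7)·deg Z(25)_ℚ = 9·5 = 45`** (new value; `1225 = 7²·25`, `gcd(7, 6·5) = 1`,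
`S_{−4}(7) = 1 + 7·(1 − (−4∕7)/7) = 9`). [cite: KudlaRapoportYang2006, §3.4 (3.4.4)–(3.4.6)] -/
theorem degree_twelvehundredtwentyfive : 2 * ∑ᶠ q : (Quot (fun x y : {x : ℤ × ℤ × ℤ // x.1 ^ 2 - 3 * x.2.1 ^ 2 - 3 * x.2.2 ^ 2 = (1225 : ℤ)} ↦
      ∃ v : ℍ[ℚ,((-1 : ℤ) : ℚ),((3 : ℤ) : ℚ)], (v ∈ order (-1) 3 ∨ v - ⟨1/2, 1/2, 1/2, -1/2⟩ ∈ order (-1) 3) ∧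
        ((v * star v).re = 1 ∨ (v * star v).re = -1) ∧
        v * ⟨0, x.1.1, x.1.2.1, x.1.2.2⟩ = ⟨0, y.1.1, y.1.2.1, y.1.2.2⟩ * v)),
        ((Nat.card
          {u : ℍ[ℚ,((-1 : ℤ) : ℚ),((3 : ℤ) : ℚ)] // (u ∈ order (-1) 3 ∨ u - ⟨1/2, 1/2, 1/2, -1/2⟩ ∈ order (-1) 3) ∧
            ((u * star u).re = 1 ∨ (u * star u).re = -1) ∧
            u * ⟨0, q.out.1.1, q.out.1.2.1, q.out.1.2.2⟩ = ⟨0, q.out.1.1, q.out.1.2.1, q.out.1.2.2⟩ * u} : ℚ))⁻¹ = 45 := by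
  have hF : conductor 0 25 = 5 := by decide +kernel
  have h := degree_sq_mul_of_coprime (m := 25) (k := 7) (by norm_num) (by rw [hF]; decide)
  have hD : tOf 0 25 (conductor 0 25) ^ 2 - 4 * nOf 0 25 (conductor 0 25) = -4 := by
    rw [disc_conductor_eq_div (by norm_num : 0 < 25), hF]; norm_num
  rw [hD] at h
  have hS : ∑ c ∈ (7 : ℕ).divisors, ((c : ℚ) * ∏ ℓ ∈ (c : ℕ).primeFactors, (1 - (jacobiSym (-4) ℓ : ℚ) / ℓ)) = 9 := by
    rw [show (7 : ℕ).divisors = {1, 7} by decide, Finset.sum_pair (by norm_num), Nat.primeFactors_one,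
      Nat.Prime.primeFactors (by norm_num : (7 : ℕ).Prime), Finset.prod_empty, Finset.prod_singleton]
    have hj : jacobiSym (-4) 7 = -1 := by norm_num
    rw [hj]; norm_num
  have e1225 : ((7 ^ 2 * 25 : ℕ) : ℤ) = 1225 := by norm_num
  have e25 : ((25 : ℕ) : ℤ) = 25 := by norm_num
  rw [hS, e1225, e25, degree_twentyfive'] at h
  rw [h]; norm_num

end Examples


end Literature.Geometry.Kaehler.ComplexTorus.QuaternionType
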